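import Summits.QuantumFields.YangMills.Theorems.SwapVirialDeficitBlowUpGnomonicFollowerFibreDefs
import Summits.QuantumFields.YangMills.Theorems.SwapVirialDeficitGnomonicTaylorLineNorm
import Summits.QuantumFields.YangMills.Theorems.SwapVirialDeficitQuantitativeLaplaceThirdSymm
import Summits.QuantumFields.YangMills.Theorems.SwapVirialDeficitQuantitativeLaplaceDetComparison
import HarnessLib

/-!
# Route `SwapVirialDeficit` (YangMills): THE FOLLOWER HESSIAN PACKAGE — operators `A_F(η)` on the Euclidean follower fibre `V_F = GnoFol L`, their coercivity at
# near-flat leader points, their Lipschitz dependence on the chart point, and the one-loop comparison `|log det A_F(η) − log det A_F(η′)| ≤ 2m·3A₃‖η − η′‖∕λ`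
# (cell ym-idea-1, skeleton ➎ (S-core)(b)(c): the follower factor `(2π∕b)^{3|Fol|∕2}∕√det A_F` is integrated EXACTLY and only ever COMPARED between nearby
# configurations — the machinery shared by `stub_core_tip` (this seat) and `stub_core_end` (LEAD memo10∕10a∕10b); free-hands support of ⟨stmt-QuantumFields-24197⟩)

At a chart point `η : GnoCoord L` (hub `a ≠ 0`, signs `ε`) the follower restriction is `G_η(y) = F̂(η + gnoFolEmb y)`, `y ∈ V_F = GnoFol L` (✓`…FollowerFibreDefs`:
`gnoFolEmb`, `fol_third_bound`, `norm_sq_gnoFol`).  This file is the follower twin of w2 g59's ✓`exists_gnoFibreHessian` (whole fibre `V_L`) plus the two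
COMPARISON statements the core bounds need:

* §1 `contDiff_gnoDeficit_folChart` (joint `C^n` in `(η, y)`), `gnoDeficit_fol_ray`, `norm_gnoFolEmb_le` (`‖gnoFolEmb y‖ ≤ ‖y‖`, sup vs Euclidean), `letterSizes_gnoFolEmb_le`,
  `fol_lineJets` (g47's line jets along follower rays, size `‖y‖`);
* §2 ★★★ `exists_gnoFolHessian` — a family `A_F : GnoCoord L → V_F →ₗ[ℝ] V_F` of SYMMETRIC operators with the bilinear ∕ form ∕ RAY identities
  `⟪A_F η y, y⟫ = (d²∕ds²) F̂(η + s·gnoFolEmb y)|₀`, joint measurability of `(η, y) ↦ ⟪A_F η y, y⟫`, `|⟪A_F η y, y⟫| ≤ 20400L⁴‖y‖²`, and the AMBIENT form identity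
  `⟪A_F η y, y⟫ = D²F̂(η)[gnoFolEmb y, gnoFolEmb y]` (so the Hessian at a displaced follower point `y₀` of `G_η` is `A_F(η + gnoFolEmb y₀)`: `gnoFolHessian_translate`);
* §3 ★★ `gnoFolHessian_coercive` — principal sector, follower signs `+`, follower coordinates `η.2.2 = 0`, leader relations `≤ s` with
  `s² ≤ μ²∕(304992000000·L⁸)`: `μ‖y‖² ≤ ⟪A_F η y, y⟫` for EVERY `y`, `μ = (2304·L⁶·|Fol L|)⁻¹` (w3 g65's ✓`gnoFollower_raySecond_coercive_gnomonic` read on the operator;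
  uniform in the hub and the leaders — bulk, tip, end, Σ alike);
* §4 ★★ `gnoDeficit_third_bound_norm` (`|D³F̂(P)[w,w,w]| ≤ 14904000L⁴‖w‖³` in the ambient sup norm, from ✓`taylor_four_gnoDeficit_line_norm`),
  ★★ `abs_gnoFolHessianForm_sub_le` — `|⟪A_F η v, v⟫ − ⟪A_F η′ v, v⟫| ≤ 44712000L⁴·‖η − η′‖·‖v‖²` for ALL chart points `η, η′` (same hub, same signs): ONE Lipschitz law
  covering leader AND follower displacements (✓`abs_hessianForm_sub_le_of_cubes` on `GnoCoord L`);
* §5 ★★ `gnoFolHessian_coercive_near` (coercivity `μ − 44712000L⁴r` on the sup-ball of radius `r` around a coercive point) and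
  ★★★ `abs_log_det_gnoFolHessian_sub_le` — `|log det A_F η − log det A_F η′| ≤ 2·(3|Fol L|)·44712000L⁴‖η − η′‖∕μ′` whenever `A_F η′` is `μ′`-coercive and
  `44712000L⁴‖η − η′‖ ≤ μ′∕2` (✓`abs_log_det_sub_log_det_le`): the MATCHING RADIUS of the follower one-loop factor is `r_m = μ′∕(89424000L⁴)` — polynomial.

HONEST LABEL: calculus ∕ linear-algebra packaging at fixed `L`; the follower Laplace ceiling∕floor, the core stubs, ⟨24197⟩ ∕ ⟨24194⟩ OPEN; own crux ⟨22884⟩ OPEN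
(blocked-on ⟨19935⟩); the Yang–Mills mass gap is NOT proved; no summit is proved by a line.  THEOREMS ONLY (0 `def`, 0 `sorry`), standard axioms, no instances.
Width seat ym-line-sfw-p2-w2 g60 (cell ym-idea-1, free hands), `--supports stmt-QuantumFields-24197`.
References: [cite: Luscher1983, §2]; [cite: HasenpflugRudolfSprungk2024, §3.1 Assumption 2]; [cite: Breitung1994, Lemma 26]; [folklore].
-/

set_option autoImplicit false
set_option synthInstance.maxSize 1024

noncomputable section

open MeasureTheory Quaternion Set Metric Module
open scoped Quaternion BigOperators ENNReal InnerProductSpace ContDiff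
open Literature.MathematicalPhysics.QuantumLattice
open Literature.MathematicalPhysics.QuantumFieldTheory hiding SU2

namespace Summit.QuantumFields.YangMills.Theorems.SwapVirialDeficit.BlowUpRing

open Summit.QuantumFields.YangMills.Theorems.FemtoTransferGap
open Summit.QuantumFields.YangMills.Theorems.FemtoTransferGap.TT
open Summit.QuantumFields.YangMills.Theorems.VirialFluxGap.RingDeficit
open Summit.QuantumFields.YangMills.Theorems.SwapVirialDeficit.SwapRing
open Summit.QuantumFields.YangMills.Theorems.SwapVirialDeficit.Gnomonic (normSq3 normSq3_nonneg taylor_four_gnoDeficit_line taylor_four_gnoDeficit_line_norm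
  contDiff_gnoDeficit)
open Summit.QuantumFields.YangMills.Theorems.QuantitativeLaplace (exists_hessianOperator iteratedFDeriv_two_eq_lineJet third_bound_of_lineJet
  measurable_inner_of_eq_fibreHessianForm abs_hessianForm_sub_le_of_cubes abs_log_det_sub_log_det_le)

variable {L : ℕ} [NeZero L]

/-! ## §1 Rays, norms and jets of the follower restriction -/

/-- `(η, y) ↦ F̂(η + gnoFolEmb y)` is `C^n` jointly (✓`contDiff_gnoDeficit` ∘ affine). [cite: Luscher1983, §2] -/
theorem contDiff_gnoDeficit_folChart (z : Fin 3 → Bool) (χ : Site 3 L → SU2) {a : ℍ} (ha : a ≠ 0) (ε : GnoSign L) {n : ℕ∞} :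
    ContDiff ℝ n fun q : GnoCoord L × GnoFol L => gnoDeficit z χ a ε (q.1 + gnoFolEmb q.2) :=
  (contDiff_gnoDeficit (n := n) z χ ha ε).comp (contDiff_fst.add ((gnoFolEmb (L := L)).contDiff.comp contDiff_snd))

/-- Rays of the follower restriction are gnomonic lines: `F̂(η + gnoFolEmb (y₀ + s·y)) = F̂((η + gnoFolEmb y₀) + s·gnoFolEmb y)`. [folklore] -/
theorem gnoDeficit_fol_ray (z : Fin 3 → Bool) (χ : Site 3 L → SU2) (a : ℍ) (ε : GnoSign L) (η : GnoCoord L) (y₀ y : GnoFol L) :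
    (fun s : ℝ => gnoDeficit z χ a ε (η + gnoFolEmb (y₀ + s • y))) = fun s : ℝ => gnoDeficit z χ a ε ((η + gnoFolEmb y₀) + s • gnoFolEmb y) := by
  funext s; rw [map_add, map_smul, add_assoc]

/-- Each follower letter of `y` has sup size `≤ ‖y‖`: `‖gnoFolBlocks y f‖ ≤ ‖y‖`. [folklore] -/
theorem norm_gnoFolBlocks_le (y : GnoFol L) (f : Fol L) : ‖gnoFolBlocks y f‖ ≤ ‖y‖ := by
  refine (pi_norm_le_iff_of_nonneg (norm_nonneg y)).2 fun k => ?_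
  show ‖y (f, k)‖ ≤ ‖y‖
  exact PiLp.norm_apply_le y (f, k)

/-- ★ The follower embedding does not increase the norm: `‖gnoFolEmb y‖ ≤ ‖y‖` (ambient sup norm vs Euclidean norm). [folklore] -/
theorem norm_gnoFolEmb_le (y : GnoFol L) : ‖gnoFolEmb y‖ ≤ ‖y‖ := by
  rw [gnoFolEmb_apply]
  have h0 : 0 ≤ ‖y‖ := norm_nonneg y
  refine max_le (max_le (by simp) (by simp)) (max_le (by simp) ?_)
  exact (pi_norm_le_iff_of_nonneg h0).2 fun f => norm_gnoFolBlocks_le y f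

/-- The letter sizes of `gnoFolEmb y`: leaders `0`, each follower `≤ ‖y‖`. [folklore] -/
theorem letterSizes_gnoFolEmb_le (y : GnoFol L) :
    Real.sqrt (∑ k, (gnoFolEmb y).1.1 k ^ 2) ≤ ‖y‖ ∧ Real.sqrt (∑ k, (gnoFolEmb y).1.2 k ^ 2) ≤ ‖y‖ ∧ Real.sqrt (∑ k, (gnoFolEmb y).2.1 k ^ 2) ≤ ‖y‖ ∧
      ∀ i, Real.sqrt (∑ k, (gnoFolEmb y).2.2 i k ^ 2) ≤ ‖y‖ := by
  have h0 : 0 ≤ ‖y‖ := norm_nonneg y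
  rw [gnoFolEmb_apply]
  refine ⟨by simp, by simp, by simp, fun i => ?_⟩
  show Real.sqrt (∑ k, gnoFolBlocks y i k ^ 2) ≤ ‖y‖
  have hle : ∑ k, gnoFolBlocks y i k ^ 2 ≤ ‖y‖ ^ 2 := by
    have h := normSq3_gnoFolBlocks_le y i
    simpa [normSq3, Fin.sum_univ_three] using h
  exact (Real.sqrt_le_sqrt hle).trans_eq (Real.sqrt_sq h0)

/-- ★ **LINE JETS along a follower ray, size `‖y‖`**: with `ψ s = F̂(η + s·gnoFolEmb y)`: `|ψ′| ≤ 720L⁴‖y‖`, `|ψ″| ≤ 20400L⁴‖y‖²`, `|ψ‴| ≤ 2484000L⁴‖y‖³`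
everywhere, and the order-2 Taylor remainder at `s = 0`. [cite: Luscher1983, §2] -/
theorem fol_lineJets (z : Fin 3 → Bool) (χ : Site 3 L → SU2) {a : ℍ} (ha : a ≠ 0) (ε : GnoSign L) (η : GnoCoord L) (y : GnoFol L) :
    (∀ s, |deriv (fun s : ℝ => gnoDeficit z χ a ε (η + s • gnoFolEmb y)) s| ≤ 720 * (L : ℝ) ^ 4 * ‖y‖ ∧
        |iteratedDeriv 2 (fun s : ℝ => gnoDeficit z χ a ε (η + s • gnoFolEmb y)) s| ≤ 20400 * (L : ℝ) ^ 4 * ‖y‖ ^ 2 ∧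
        |iteratedDeriv 3 (fun s : ℝ => gnoDeficit z χ a ε (η + s • gnoFolEmb y)) s| ≤ 2484000 * (L : ℝ) ^ 4 * ‖y‖ ^ 3) ∧
      |gnoDeficit z χ a ε (η + gnoFolEmb y) - gnoDeficit z χ a ε η - deriv (fun s : ℝ => gnoDeficit z χ a ε (η + s • gnoFolEmb y)) 0 -
          iteratedDeriv 2 (fun s : ℝ => gnoDeficit z χ a ε (η + s • gnoFolEmb y)) 0 / 2| ≤ 2484000 * (L : ℝ) ^ 4 * ‖y‖ ^ 3 / 2 := by
  obtain ⟨hx, hy, hz, hf⟩ := letterSizes_gnoFolEmb_le (L := L) y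
  obtain ⟨hall, h2, -⟩ := taylor_four_gnoDeficit_line z χ ha ε η (gnoFolEmb y) (norm_nonneg y) hx hy hz hf
  exact ⟨fun s => ⟨(hall s).1, (hall s).2.1, (hall s).2.2.1⟩, h2⟩

/-! ## §2 The follower Hessian operators -/

/-- ★★★ **THE FOLLOWER HESSIAN OPERATORS.**  For every sector `z`, character `χ`, hub `a ≠ 0` and signs `ε` there is a family `A_F : GnoCoord L → V_F →ₗ[ℝ] V_F`
(indexed by the chart point `η`) of SYMMETRIC operators on the follower fibre `V_F = GnoFol L` with: the bilinear identity `⟪A_F η y, w⟫ = D(D(F̂(η + gnoFolEmb ·)))(0)[y][w]`,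
the form identity, the RAY identity `⟪A_F η y, y⟫ = (d²∕ds²) F̂(η + s·gnoFolEmb y)|₀`, the AMBIENT identity `⟪A_F η y, y⟫ = D²F̂(η)[gnoFolEmb y, gnoFolEmb y]`, the joint
MEASURABILITY of `(η, y) ↦ ⟪A_F η y, y⟫`, and `|⟪A_F η y, y⟫| ≤ 20400L⁴‖y‖²`. [cite: Luscher1983, §2] [cite: HasenpflugRudolfSprungk2024, §3.1 Assumption 2] -/
theorem exists_gnoFolHessian (z : Fin 3 → Bool) (χ : Site 3 L → SU2) {a : ℍ} (ha : a ≠ 0) (ε : GnoSign L) :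
    ∃ A : GnoCoord L → GnoFol L →ₗ[ℝ] GnoFol L,
      (∀ η, (A η).IsSymmetric) ∧
      (∀ η (y w : GnoFol L), ⟪A η y, w⟫_ℝ = fderiv ℝ (fderiv ℝ (fun y' : GnoFol L => gnoDeficit z χ a ε (η + gnoFolEmb y'))) 0 y w) ∧
      (∀ η (y : GnoFol L), ⟪A η y, y⟫_ℝ = iteratedFDeriv ℝ 2 (fun y' : GnoFol L => gnoDeficit z χ a ε (η + gnoFolEmb y')) 0 (fun _ => y)) ∧
      (∀ η (y : GnoFol L), ⟪A η y, y⟫_ℝ = iteratedDeriv 2 (fun s : ℝ => gnoDeficit z χ a ε (η + s • gnoFolEmb y)) 0) ∧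
      (∀ η (y : GnoFol L), ⟪A η y, y⟫_ℝ = iteratedFDeriv ℝ 2 (gnoDeficit z χ a ε) η (fun _ => gnoFolEmb y)) ∧
      (Measurable fun q : GnoCoord L × GnoFol L => ⟪A q.1 q.2, q.2⟫_ℝ) ∧
      (∀ η (y : GnoFol L), |⟪A η y, y⟫_ℝ| ≤ 20400 * (L : ℝ) ^ 4 * ‖y‖ ^ 2) := by
  have h2 : (2 : WithTop ℕ∞) ≤ 2 := le_rfl
  have hex := fun η : GnoCoord L => exists_hessianOperator ((contDiff_gnoDeficit_fol (n := 2) z χ ha ε η).contDiffAt (x := (0 : GnoFol L))) h2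
  choose A hAs hAyw hAyy using hex
  -- the ray identity
  have hray : ∀ η (y : GnoFol L), ⟪A η y, y⟫_ℝ = iteratedDeriv 2 (fun s : ℝ => gnoDeficit z χ a ε (η + s • gnoFolEmb y)) 0 := fun η y => by
    rw [hAyy, iteratedFDeriv_two_eq_lineJet (contDiff_gnoDeficit_fol (n := 2) z χ ha ε η) 0 y, gnoDeficit_fol_ray, map_zero, add_zero]
  -- the ambient identity (line restriction of `F̂` itself on `GnoCoord L`)
  have hamb : ∀ η (y : GnoFol L), ⟪A η y, y⟫_ℝ = iteratedFDeriv ℝ 2 (gnoDeficit z χ a ε) η (fun _ => gnoFolEmb y) := fun η y => by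
    rw [hray]
    have e := Literature.Analysis.Calculus.iteratedDeriv_lineRestriction (n := 2) (contDiff_gnoDeficit (n := 2) z χ ha ε) η (gnoFolEmb y) 0
    rw [zero_smul, add_zero] at e
    exact e
  refine ⟨A, hAs, hAyw, hAyy, hray, hamb, ?_, fun η y => ?_⟩
  · have h2' : (2 : WithTop ℕ∞) ≤ ((2 : ℕ∞) : WithTop ℕ∞) := le_rfl
    exact measurable_inner_of_eq_fibreHessianForm (G := fun q : GnoCoord L × GnoFol L => gnoDeficit z χ a ε (q.1 + gnoFolEmb q.2))
      (contDiff_gnoDeficit_folChart (n := 2) z χ ha ε) h2' (M := GnoCoord L) (ι := id) continuous_id (ys := fun _ => (0 : GnoFol L)) continuous_const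
      (A := fun η y => A η y) (B := fun _ y => y) (fun η y => hAyy η y)
  · rw [hray]; exact ((fol_lineJets z χ ha ε η y).1 0).2.1

/-- ★ **TRANSLATION**: the Hessian form of `G_η = F̂(η + gnoFolEmb ·)` at a displaced follower point `y₀` is the family member at the translated chart point:
`D²G_η(y₀)[v,v] = ⟪A_F (η + gnoFolEmb y₀) v, v⟫` — for any family with the ray identity. [folklore] -/
theorem gnoFolHessian_translate (z : Fin 3 → Bool) (χ : Site 3 L → SU2) {a : ℍ} (ha : a ≠ 0) (ε : GnoSign L)
    {A : GnoCoord L → GnoFol L →ₗ[ℝ] GnoFol L}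
    (hray : ∀ η (y : GnoFol L), ⟪A η y, y⟫_ℝ = iteratedDeriv 2 (fun s : ℝ => gnoDeficit z χ a ε (η + s • gnoFolEmb y)) 0)
    (η : GnoCoord L) (y₀ v : GnoFol L) :
    iteratedFDeriv ℝ 2 (fun y' : GnoFol L => gnoDeficit z χ a ε (η + gnoFolEmb y')) y₀ (fun _ => v) = ⟪A (η + gnoFolEmb y₀) v, v⟫_ℝ := by
  rw [hray, iteratedFDeriv_two_eq_lineJet (contDiff_gnoDeficit_fol (n := 2) z χ ha ε η) y₀ v, gnoDeficit_fol_ray]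

/-! ## §3 Coercivity at near-flat leader points (principal sector, follower signs `+`) -/

omit [NeZero L] in
/-- The blocks of a scaled follower vector. [folklore] -/
theorem gnoFolBlocks_smul (s : ℝ) (y : GnoFol L) : gnoFolBlocks (s • y) = s • gnoFolBlocks y := by
  funext f k; rfl

/-- The follower ray in chart letters: `F̂(η + s·gnoFolEmb y) = F̂₀(C, gno⁺(s·Y))`, `Y = gnoFolBlocks y`, `C = (blowUpPoint 1 (gnomonicPoint a ε η)).1`
(follower signs `+`, follower coordinates of `η` zero). [folklore] -/
theorem gnoDeficit_fol_ray_eq_chart (z : Fin 3 → Bool) (χ : Site 3 L → SU2) (a : ℍ) (ε : GnoSign L) (η : GnoCoord L)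
    (hε : ε.2.2 = fun _ => true) (hη : η.2.2 = 0) (y : GnoFol L) (s : ℝ) :
    gnoDeficit z χ a ε (η + s • gnoFolEmb y) =
      chartDeficit L z χ ((blowUpPoint 1 (gnomonicPoint a ε η)).1, fun f => quatToSU2 (gnoLetter true ((s • gnoFolBlocks y) f))) := by
  rw [gnoFolEmb_apply]
  exact gnoDeficit_followerLine_eq z χ a ε η hε hη (gnoFolBlocks y) s

/-- ★★ **COERCIVITY OF THE FOLLOWER HESSIAN AT A NEAR-FLAT LEADER POINT** (principal sector): hub `a ≠ 0`, follower signs `+`, follower coordinates `η.2.2 = 0`,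
the leader tuple `C = (blowUpPoint 1 (gnomonicPoint a ε η)).1` with commutators and σ-relations `≤ s` (Frobenius), and `s² ≤ μ²∕(304992000000·L⁸)` with
`μ = (2304·L⁶·|Fol L|)⁻¹`.  Then `μ‖y‖² ≤ ⟪A_F η y, y⟫` for EVERY `y : V_F` — for any operator family with the ray identity (✓`gnoFollower_raySecond_coercive_gnomonic`
with `R² = μ∕(254160000L⁴)`).  Uniform in the hub angle and in the leaders: bulk, tip, end, Σ alike. [cite: Luscher1983, §2] -/
theorem gnoFolHessian_coercive {a : ℍ} (ha : a ≠ 0) (ε : GnoSign L) (hε : ε.2.2 = fun _ => true) (η : GnoCoord L) (hη : η.2.2 = 0)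
    {A : GnoCoord L → GnoFol L →ₗ[ℝ] GnoFol L}
    (hray : ∀ η' (y : GnoFol L), ⟪A η' y, y⟫_ℝ = iteratedDeriv 2 (fun s : ℝ => gnoDeficit (fun _ => false) (fun _ => 1) a ε (η' + s • gnoFolEmb y)) 0)
    {s : ℝ} (hs : 0 ≤ s)
    (hCC : ∀ μ ν : Fin 3, frobNorm ((((blowUpPoint 1 (gnomonicPoint a ε η)).1 (Fin.castSucc μ) * (blowUpPoint 1 (gnomonicPoint a ε η)).1 (Fin.castSucc ν) : SU2) :
        Matrix (Fin 2) (Fin 2) ℂ) - (((blowUpPoint 1 (gnomonicPoint a ε η)).1 (Fin.castSucc ν) * (blowUpPoint 1 (gnomonicPoint a ε η)).1 (Fin.castSucc μ) : SU2) :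
        Matrix (Fin 2) (Fin 2) ℂ)) ≤ s)
    (hσ : ∀ μ : Fin 3, frobNorm ((((blowUpPoint 1 (gnomonicPoint a ε η)).1 (Fin.last 3) *
        (blowUpPoint 1 (gnomonicPoint a ε η)).1 (Fin.castSucc (Equiv.swap (0 : Fin 3) 1 μ)) : SU2) : Matrix (Fin 2) (Fin 2) ℂ) -
        (((blowUpPoint 1 (gnomonicPoint a ε η)).1 (Fin.castSucc μ) * (blowUpPoint 1 (gnomonicPoint a ε η)).1 (Fin.last 3) : SU2) : Matrix (Fin 2) (Fin 2) ℂ)) ≤ s)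
    (hs2 : s ^ 2 ≤ ((2304 * (L : ℝ) ^ 6 * (Fintype.card (Fol L) : ℝ))⁻¹) ^ 2 / (304992000000 * (L : ℝ) ^ 8)) (y : GnoFol L) :
    (2304 * (L : ℝ) ^ 6 * (Fintype.card (Fol L) : ℝ))⁻¹ * ‖y‖ ^ 2 ≤ ⟪A η y, y⟫_ℝ := by
  set μ : ℝ := (2304 * (L : ℝ) ^ 6 * (Fintype.card (Fol L) : ℝ))⁻¹ with hμ
  have hL : (1 : ℝ) ≤ (L : ℝ) := by exact_mod_cast Nat.one_le_iff_ne_zero.2 (NeZero.ne L)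
  have hL4 : (1 : ℝ) ≤ (L : ℝ) ^ 4 := one_le_pow₀ hL
  have hcard : (1 : ℝ) ≤ (Fintype.card (Fol L) : ℝ) := by
    have hL1 : 1 ≤ L := Nat.one_le_iff_ne_zero.2 (NeZero.ne L)
    have h6 : 6 ≤ 6 * L ^ 4 := by nlinarith [Nat.one_le_pow 4 L hL1]
    have : 1 ≤ Fintype.card (Fol L) := by rw [card_fol]; omega
    exact_mod_cast this
  have hμpos : 0 < μ := by rw [hμ]; positivity
  have hμle : μ ≤ 1 := by
    rw [hμ]
    refine inv_le_one_of_one_le₀ ?_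
    have hL6 : (1 : ℝ) ≤ (L : ℝ) ^ 6 := one_le_pow₀ hL
    nlinarith
  -- the radius `R² = μ∕(254160000 L⁴)`
  set R : ℝ := Real.sqrt (μ / (254160000 * (L : ℝ) ^ 4)) with hR
  have hRpos : 0 < R := Real.sqrt_pos.2 (by positivity)
  have hR2 : R ^ 2 = μ / (254160000 * (L : ℝ) ^ 4) := Real.sq_sqrt (by positivity)
  have hR1 : R ≤ 1 := by
    rw [← Real.sqrt_one]
    refine Real.sqrt_le_sqrt ?_
    rw [div_le_one (by positivity)]
    nlinarith
  have hsmall₂ : 2 * (63540000 * (L : ℝ) ^ 4) * R ^ 2 ≤ μ / 2 := by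
    rw [hR2]; field_simp; ring_nf; nlinarith [hμpos]
  have hsmall₁ : 2 * (300 * (L : ℝ) ^ 4 * s ^ 2) ≤ μ * R ^ 2 / 2 := by
    rw [hR2]
    have h1 : 2 * (300 * (L : ℝ) ^ 4 * s ^ 2) ≤ 600 * (L : ℝ) ^ 4 * (μ ^ 2 / (304992000000 * (L : ℝ) ^ 8)) := by nlinarith
    refine h1.trans (le_of_eq ?_)
    field_simp
    ring
  have h := gnoFollower_raySecond_coercive_gnomonic ha ε η hε hη hs hRpos hR1 hCC hσ hsmall₁ hsmall₂ (gnoFolBlocks y)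
  have e : (fun t : ℝ => gnoDeficit (fun _ => false) (fun _ => 1) a ε (η + t • gnoFolEmb y)) =
      fun t : ℝ => chartDeficit L (fun _ => false) (fun _ => 1) ((blowUpPoint 1 (gnomonicPoint a ε η)).1, fun f => quatToSU2 (gnoLetter true ((t • gnoFolBlocks y) f))) :=
    funext fun t => gnoDeficit_fol_ray_eq_chart _ _ a ε η hε hη y t
  have hn : ∑ f, normSq3 (gnoFolBlocks y f) = ‖y‖ ^ 2 := (norm_sq_gnoFol y).symm
  rw [hn] at h
  rw [hray, e]
  exact h

/-! ## §4 Lipschitz dependence of the follower Hessian form on the chart point -/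

/-- `(√3)³ ≤ 6`. [folklore] -/
theorem sqrt_three_pow_three_le : Real.sqrt 3 ^ 3 ≤ 6 := by
  have h3 : Real.sqrt 3 ^ 2 = 3 := Real.sq_sqrt (by norm_num)
  have hle : Real.sqrt 3 ≤ 2 := by
    rw [show (2 : ℝ) = Real.sqrt 4 by rw [show (4 : ℝ) = 2 ^ 2 by norm_num, Real.sqrt_sq (by norm_num)]]
    exact Real.sqrt_le_sqrt (by norm_num)
  have h0 : 0 ≤ Real.sqrt 3 := Real.sqrt_nonneg _
  nlinarith

/-- ★★ **THE DIRECTIONAL THIRD DERIVATIVE OF `F̂` IN THE AMBIENT NORM**: `|D³F̂(P)[w,w,w]| ≤ 14904000L⁴‖w‖³` at EVERY chart point `P`, every direction `w : GnoCoord L`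
(sup norm) — ✓`taylor_four_gnoDeficit_line_norm` through ✓`iteratedDeriv_lineRestriction`, with `(√3)³ ≤ 6`. [cite: Luscher1983, §2] -/
theorem gnoDeficit_third_bound_norm (z : Fin 3 → Bool) (χ : Site 3 L → SU2) {a : ℍ} (ha : a ≠ 0) (ε : GnoSign L) (P w : GnoCoord L) :
    |iteratedFDeriv ℝ 3 (gnoDeficit z χ a ε) P (fun _ => w)| ≤ 14904000 * (L : ℝ) ^ 4 * ‖w‖ ^ 3 := by
  have e := Literature.Analysis.Calculus.iteratedDeriv_lineRestriction (n := 3) (contDiff_gnoDeficit (n := 3) z χ ha ε) P w 0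
  rw [zero_smul, add_zero] at e
  rw [← e]
  have h := ((taylor_four_gnoDeficit_line_norm z χ ha ε P w).1 0).2.2.1
  refine h.trans ?_
  rw [mul_pow]
  have hw : 0 ≤ ‖w‖ ^ 3 := by positivity
  have hL : 0 ≤ (L : ℝ) ^ 4 := by positivity
  nlinarith [sqrt_three_pow_three_le, mul_nonneg hL hw]

/-- ★★ **THE FOLLOWER HESSIAN FORM IS LIPSCHITZ IN THE CHART POINT**: `|⟪A_F η v, v⟫ − ⟪A_F η′ v, v⟫| ≤ 44712000L⁴·‖η − η′‖·‖v‖²` for ALL `η, η′ : GnoCoord L`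
(same hub, same signs; any family with the ambient identity) — one law for leader AND follower displacements (✓`abs_hessianForm_sub_le_of_cubes` on the ambient chart,
`‖gnoFolEmb v‖ ≤ ‖v‖`). [folklore] -/
theorem abs_gnoFolHessianForm_sub_le (z : Fin 3 → Bool) (χ : Site 3 L → SU2) {a : ℍ} (ha : a ≠ 0) (ε : GnoSign L)
    {A : GnoCoord L → GnoFol L →ₗ[ℝ] GnoFol L}
    (hamb : ∀ η (y : GnoFol L), ⟪A η y, y⟫_ℝ = iteratedFDeriv ℝ 2 (gnoDeficit z χ a ε) η (fun _ => gnoFolEmb y))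
    (η η' : GnoCoord L) (v : GnoFol L) :
    |⟪A η v, v⟫_ℝ - ⟪A η' v, v⟫_ℝ| ≤ 44712000 * (L : ℝ) ^ 4 * ‖η - η'‖ * ‖v‖ ^ 2 := by
  rw [hamb, hamb]
  have h := abs_hessianForm_sub_le_of_cubes (contDiff_gnoDeficit (n := 3) z χ ha ε) convex_univ (A₃ := 14904000 * (L : ℝ) ^ 4) (by positivity)
    (fun P _ w => gnoDeficit_third_bound_norm z χ ha ε P w) (mem_univ η) (mem_univ η') (gnoFolEmb v)
  refine h.trans ?_
  have hT : ‖gnoFolEmb v‖ ^ 2 ≤ ‖v‖ ^ 2 := pow_le_pow_left₀ (norm_nonneg _) (norm_gnoFolEmb_le v) 2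
  have hc : 0 ≤ 3 * (14904000 * (L : ℝ) ^ 4) * ‖η - η'‖ := by positivity
  calc 3 * (14904000 * (L : ℝ) ^ 4) * ‖η - η'‖ * ‖gnoFolEmb v‖ ^ 2 ≤ 3 * (14904000 * (L : ℝ) ^ 4) * ‖η - η'‖ * ‖v‖ ^ 2 :=
        mul_le_mul_of_nonneg_left hT hc
    _ = 44712000 * (L : ℝ) ^ 4 * ‖η - η'‖ * ‖v‖ ^ 2 := by ring

/-! ## §5 Coercivity nearby and the one-loop comparison -/

/-- ★★ **COERCIVITY TRANSFER IN THE CHART POINT**: if `A_F η₀` is `μ′`-coercive then `A_F η` is `(μ′ − 44712000L⁴‖η − η₀‖)`-coercive — e.g. the Hessian at the follower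
minimiser `η₀ + gnoFolEmb y⋆` (✓`gnoFolHessian_translate`) inherits `μ′∕2` once `44712000L⁴‖y⋆‖ ≤ μ′∕2`. [folklore] -/
theorem gnoFolHessian_coercive_near (z : Fin 3 → Bool) (χ : Site 3 L → SU2) {a : ℍ} (ha : a ≠ 0) (ε : GnoSign L)
    {A : GnoCoord L → GnoFol L →ₗ[ℝ] GnoFol L}
    (hamb : ∀ η (y : GnoFol L), ⟪A η y, y⟫_ℝ = iteratedFDeriv ℝ 2 (gnoDeficit z χ a ε) η (fun _ => gnoFolEmb y))
    {η₀ : GnoCoord L} {μ' : ℝ} (hcoer : ∀ y : GnoFol L, μ' * ‖y‖ ^ 2 ≤ ⟪A η₀ y, y⟫_ℝ) (η : GnoCoord L) (y : GnoFol L) :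
    (μ' - 44712000 * (L : ℝ) ^ 4 * ‖η - η₀‖) * ‖y‖ ^ 2 ≤ ⟪A η y, y⟫_ℝ := by
  have h := abs_gnoFolHessianForm_sub_le z χ ha ε hamb η η₀ y
  have h1 := hcoer y
  have h2 := (abs_le.1 h).1
  nlinarith

/-- ★★★ **THE ONE-LOOP COMPARISON OF THE FOLLOWER FACTOR**: if `A_F η′` is `μ′`-coercive (`μ′ > 0`) and `44712000L⁴‖η − η′‖ ≤ μ′∕2`, then
`|log det A_F η − log det A_F η′| ≤ 2·(3|Fol L|)·(44712000L⁴‖η − η′‖)∕μ′` — the follower one-loop weight `(det A_F)^{−1∕2}` changes by at most the factor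
`exp(3|Fol L|·44712000L⁴‖η − η′‖∕μ′)` between chart points at sup distance `‖η − η′‖`: MATCHING RADIUS `r_m = μ′∕(89424000·L⁴·3|Fol L|)` for a factor `e`
(✓`abs_log_det_sub_log_det_le`, `m = 3|Fol L|` ✓`finrank_gnoFol_real`). [cite: Breitung1994, Lemma 26] -/
theorem abs_log_det_gnoFolHessian_sub_le (z : Fin 3 → Bool) (χ : Site 3 L → SU2) {a : ℍ} (ha : a ≠ 0) (ε : GnoSign L)
    {A : GnoCoord L → GnoFol L →ₗ[ℝ] GnoFol L} (hAs : ∀ η, (A η).IsSymmetric)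
    (hamb : ∀ η (y : GnoFol L), ⟪A η y, y⟫_ℝ = iteratedFDeriv ℝ 2 (gnoDeficit z χ a ε) η (fun _ => gnoFolEmb y))
    {η η' : GnoCoord L} {μ' : ℝ} (hμ : 0 < μ') (hcoer : ∀ y : GnoFol L, μ' * ‖y‖ ^ 2 ≤ ⟪A η' y, y⟫_ℝ)
    (hnear : 44712000 * (L : ℝ) ^ 4 * ‖η - η'‖ ≤ μ' / 2) :
    |Real.log (LinearMap.det (A η)) - Real.log (LinearMap.det (A η'))| ≤
      2 * (3 * (Fintype.card (Fol L) : ℝ)) * (44712000 * (L : ℝ) ^ 4 * ‖η - η'‖) / μ' := by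
  have h := abs_log_det_sub_log_det_le (hAs η) (hAs η') hμ (by positivity) hnear hcoer
    (fun y => abs_gnoFolHessianForm_sub_le z χ ha ε hamb η η' y)
  rw [← finrank_gnoFol_real (L := L)]
  exact h

end Summit.QuantumFields.YangMills.Theorems.SwapVirialDeficit.BlowUpRing

end
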